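import Summits.BirchSwinnertonDyer.BirchSwinnertonDyer.Theorems.ThetaPartnerAtTwoSignedKatoUpToAtTwoLayerPoitouTateShapiro
import Literature.NumberTheory.EllipticCurves.Kato2004.ShapiroCupLevelTransport
import Literature.NumberTheory.EllipticCurves.BSDConductorProofs
import HarnessLib

/-!
# Route `ThetaPartnerAtTwo` (TP2), crux K3 `SignedKatoDivisibilityUpToAtTwo` (item stmt-BirchSwinnertonDyer-20308) /
# K3P′ (item 25631), line `colemanrat` v7 — (PT-orth) step S2: Poitou–Tate in the SHAPIRO model for the WEIL cup classes
# `Sh((r_L)_* red_{p^L} x) ∪_{Σ e_L} Sh[ψ_L]`, UNCONDITIONALLY in the level transport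

Width seat `bsd-wall-tp2-p2x-w2` g4 (cell `bsd-wall`), for the lead `bsd-wall-tp2-p2x` g5. HONEST FRAMING: THEOREMS ONLY (no
definition, no named fact, no instance, no `sorry`); closes no item; BSD is NOT proved by any of this.

The lead's assembly `SignedKatoOffTwo.LayerPT.two_nsmul_localInvariantMap_cup_shapiroLift_eq_zero` (`…LayerPoitouTateShapiro.lean`)
proves `2 • inv_{v₀}(loc_{v₀} c_{L₀}) = 0` for the cup classes `c_L = a_L ∪_{P_L} Sh[ψ_L]` MODULO the level-transport hypothesis
`htrans : c_L = (ι_μ)_* c_{L₀}`. This file DISCHARGES `htrans` for the classes of the application — first factors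
`a_L = Sh_{Γ_N}((r_L)_* red_{p^L} x)` for ONE `x ∈ H¹(Γ_N, T_pE)` (`Kato2004.reduceH1Pk`, re-typed to the levels `((p^L : ℕ) : ℤ)` by any
maps `r_L` which are the identity on points), pairings `P_L =` the summed pairing (`ContPairing.coindFin`) of a tower-compatible family of
Weil pairings `e_L : E[p^L] × E[p^L] → μ_{p^L}` — by the Literature theorem `Kato2004.shapiroCup_weil_htrans_reduceH1Pk`
(`Literature/NumberTheory/EllipticCurves/Kato2004/ShapiroCupLevelTransport.lean`: projection formula for the summed cup product on
Shapiro lifts + Silverman III.8.1 (e) + `p^{L−L₀}(a mod p^L) = a mod p^{L₀}`), over `K = ℚ`.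

## What is proved
* `two_nsmul_localInvariantMap_weilShapiroCup_eq_zero` — over `ℚ`, for a `ℤ_p`-extension `κ`, a layer `N`, the place `v₀` above `p`
  (hypothesis `hv₀`: every other finite place is prime to `p`), `t ∈ Sel_{p^∞}(E/ℚ_N)` with cocycle `φ_N` and finite-level lifts
  `ψ_L : Γ_N → E[p^L]` (`L ≥ L₀`, same values as `φ_N`), a tower-compatible family `e` (hypothesis `hcompat`, discharged for the tree's
  `weilPairingFun` by `weilPairingFun_hcompat_pow`), re-typings `r_L`, and `x ∈ H¹(Γ_N, T_pE)`:
  `2 • inv_{v₀}( loc_{v₀}( Sh((r_{L₀})_* red_{p^{L₀}} x) ∪_{Σ e_{L₀}} Sh[ψ_{L₀}] ) ) = 0`.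

What remains for (PT-orth) (lead's T3 / w3's bricks, not here): the identification of this invariant with the (D-layer) pairing
`layerPairingMod` at `v₀ ∣ p` and the `ℤ_p`-glue over the levels.

References: [Kobayashi2003] (7.16)–(7.21) (p. 12); [Kato2004Asterisque] §13.8 (p. 228), §17.13 (p. 279); [MilneADT2006] Ch. I Thm. 4.10;
[SilvermanAEC2009] Prop. III.8.1 (e); [NeukirchSchmidtWingberg2008] I §4 (1.4.2), I §6 (1.6.4).
-/

set_option autoImplicit false
-- the Theorems namespace of this sub repeats the summit name by design (D-0017 nested layout)
set_option linter.dupNamespace false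

noncomputable section

open scoped Classical ContRepresentation

namespace Summit.BirchSwinnertonDyer.BirchSwinnertonDyer.Theorems

namespace SignedKatoOffTwo.LayerPTW2

open CategoryTheory NumberField IsDedekindDomain Field ContinuousCohomology
  Literature.NumberTheory.EllipticCurves Literature.NumberTheory.EllipticCurves.GreenbergSelmer
  Literature.NumberTheory.EllipticCurves.Kato2004 Literature.NumberTheory.EllipticCurves.Kato2004.EulerSystemValues
  Literature.NumberTheory.GaloisRepresentations Literature.NumberTheory.GaloisRepresentations.DiscreteGaloisModule
  Literature.NumberTheory.GaloisCohomology ZpExtension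
open WeierstrassCurve (geomPoints geomTorsion)

variable (W : WeierstrassCurve ℚ) [W.IsElliptic] {p : ℕ} [hp : Fact p.Prime] [ContinuousSMul ℤ_[p] (W.tateModule p)]
  (κ : ZpExtension ℚ p) (N : ℕ)
  {s : absoluteGaloisGroup ℚ ⧸ κ.layerSubgroup N → absoluteGaloisGroup ℚ}
  (hs : ∀ x, (s x : absoluteGaloisGroup ℚ ⧸ κ.layerSubgroup N) = x)
  (hs1 : s ((1 : absoluteGaloisGroup ℚ) : absoluteGaloisGroup ℚ ⧸ κ.layerSubgroup N) = 1)

/-- **Poitou–Tate for the Weil/Shapiro cup classes of a layer Selmer class and a class of `H¹(Γ_N, T_pE)`, over `ℚ`.**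
For `t ∈ Sel_{p^∞}(E/ℚ_N)` with cocycle `φ_N`, finite-level lifts `ψ_L : Γ_N → E[p^L]` of `φ_N` (`L ≥ L₀`), a tower-compatible family of
`Γ_ℚ`-equivariant biadditive pairings `e_L : E[p^L] × E[p^L] → μ_{p^L}` (`hcompat`), re-typings `r_L : E[(p:ℤ)^L] → E[((p^L:ℕ):ℤ)]`
(identity on points), `x ∈ H¹(Γ_N, T_pE)`, and the place `v₀` with every other finite place prime to `p`:
`2 • inv_{v₀}( loc_{v₀}( Sh_{Γ_N}((r_{L₀})_* red_{p^{L₀}} x) ∪_{Σ e_{L₀}} Sh_{Γ_N}[ψ_{L₀}] ) ) = 0` — the lead's conditional assembly with its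
hypothesis `htrans` discharged by `Kato2004.shapiroCup_weil_htrans_reduceH1Pk`. [cite: Kobayashi2003, (7.16)–(7.21) (p. 12)]
[cite: MilneADT2006, Ch. I, Thm. 4.10(b)] [cite: SilvermanAEC2009, Prop. III.8.1(e)] -/
theorem two_nsmul_localInvariantMap_weilShapiroCup_eq_zero [Fintype (absoluteGaloisGroup ℚ ⧸ κ.layerSubgroup N)]
    (v₀ : HeightOneSpectrum (𝓞 ℚ)) (hv₀ : ∀ v : HeightOneSpectrum (𝓞 ℚ), v ≠ v₀ → ((p : ℕ) : 𝓞 ℚ) ∉ v.asIdeal)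
    {t : W.subgroupH1 p (κ.layerSubgroup N)} (ht : t ∈ W.selmerLayer κ N)
    (φN : contOneCocycles (discreteTopRep (κ.layerSubgroup N) (W.geomPrimaryTorsion p))) (hφN : oneCocycleClass _ φN = t)
    (L₀ : ℕ)
    (ψ : ∀ L : ℕ, L₀ ≤ L →
      contOneCocycles (subgroupRep (W.torsionGaloisModule ((p ^ L : ℕ) : ℤ)).toTopRep (κ.layerSubgroup N)))
    (hψ : ∀ (L : ℕ) (hL : L₀ ≤ L) (y : κ.layerSubgroup N),
      (((ψ L hL).1 y : geomTorsion W ((p ^ L : ℕ) : ℤ)) : W.geomPoints) = ((φN.1 y : W.geomPrimaryTorsion p) : W.geomPoints))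
    (e : ∀ L : ℕ, geomTorsion W ((p ^ L : ℕ) : ℤ) → geomTorsion W ((p ^ L : ℕ) : ℤ) → AlgebraicClosure ℚ)
    (hμ : ∀ (L : ℕ) S T, e L S T ^ (p ^ L) = 1)
    (hadd₁ : ∀ (L : ℕ) S₁ S₂ T, e L (S₁ + S₂) T = e L S₁ T * e L S₂ T)
    (hadd₂ : ∀ (L : ℕ) S T₁ T₂, e L S (T₁ + T₂) = e L S T₁ * e L S T₂)
    (hgal : ∀ (L : ℕ) (σ : absoluteGaloisGroup ℚ) S T, σ • e L S T = e L (σ • S) (σ • T))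
    (hcompat : ∀ (L : ℕ) (_ : L₀ ≤ L)
      (α : (W.torsionGaloisModule ((p ^ L : ℕ) : ℤ)).toContRepresentation →ⁱL
        (W.torsionGaloisModule ((p ^ L₀ : ℕ) : ℤ)).toContRepresentation)
      (β : (W.torsionGaloisModule ((p ^ L₀ : ℕ) : ℤ)).toContRepresentation →ⁱL
        (W.torsionGaloisModule ((p ^ L : ℕ) : ℤ)).toContRepresentation),
      (∀ S, ((α S : geomTorsion W ((p ^ L₀ : ℕ) : ℤ)) : geomPoints W) = (p : ℤ) ^ (L - L₀) • (S : geomPoints W)) →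
      (∀ T, ((β T : geomTorsion W ((p ^ L : ℕ) : ℤ)) : geomPoints W) = (T : geomPoints W)) →
      ∀ (S' : geomTorsion W ((p ^ L : ℕ) : ℤ)) (T : geomTorsion W ((p ^ L₀ : ℕ) : ℤ)), e L S' (β T) = e L₀ (α S') T)
    (r : ∀ L : ℕ, geomTorsion W ((p : ℤ) ^ L) →+ geomTorsion W ((p ^ L : ℕ) : ℤ))
    (hrc : ∀ L : ℕ, Continuous (r L))
    (hrρ : ∀ (L : ℕ) (u : κ.layerSubgroup N) (P : geomTorsion W ((p : ℤ) ^ L)),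
      r L ((subgroupRep (W.torsionGaloisModule ((p : ℤ) ^ L)).toTopRep (κ.layerSubgroup N)).ρ u P) =
        (subgroupRep (W.torsionGaloisModule ((p ^ L : ℕ) : ℤ)).toTopRep (κ.layerSubgroup N)).ρ u (r L P))
    (hr : ∀ (L : ℕ) (P : geomTorsion W ((p : ℤ) ^ L)), ((r L P : geomTorsion W ((p ^ L : ℕ) : ℤ)) : geomPoints W) = P)
    (x : H1 (tateRep W p) (κ.layerSubgroup N)) :
    haveI : CompactSpace (absoluteGaloisGroup ℚ) := absoluteGaloisGroup_compactSpace ℚ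
    2 • localInvariantMap ℚ (p ^ L₀) v₀ (galoisCohomology.localization (mu ℚ (p ^ L₀)) (Sum.inr v₀) 2
      (((weilContPairing W (p ^ L₀) (e L₀) (hμ L₀) (hadd₁ L₀) (hadd₂ L₀) (hgal L₀)).coindFin (κ.layerSubgroup N)).cupProduct
        (shapiroLift (W.torsionGaloisModule ((p ^ L₀ : ℕ) : ℤ)).toTopRep (κ.layerSubgroup N) (κ.isOpen_layerSubgroup N) hs hs1
          (mapH1AddHom (subgroupRep (W.torsionGaloisModule ((p : ℤ) ^ L₀)).toTopRep (κ.layerSubgroup N))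
            (subgroupRep (W.torsionGaloisModule ((p ^ L₀ : ℕ) : ℤ)).toTopRep (κ.layerSubgroup N)) (r L₀) (hrc L₀) (hrρ L₀)
            (reduceH1Pk W p L₀ (κ.layerSubgroup N) x)))
        (shapiroLift (W.torsionGaloisModule ((p ^ L₀ : ℕ) : ℤ)).toTopRep (κ.layerSubgroup N) (κ.isOpen_layerSubgroup N) hs hs1
          (oneCocycleClass _ (ψ L₀ le_rfl))))) = 0 := by
  haveI : CompactSpace (absoluteGaloisGroup ℚ) := absoluteGaloisGroup_compactSpace ℚ
  exact LayerPT.two_nsmul_localInvariantMap_cup_shapiroLift_eq_zero W κ N hs hs1 v₀ hv₀ ht φN hφN L₀ ψ hψ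
    (fun L _ ↦ coindFin (W.torsionGaloisModule ((p ^ L : ℕ) : ℤ)).toTopRep (κ.layerSubgroup N))
    (fun L _ ↦ (weilContPairing W (p ^ L) (e L) (hμ L) (hadd₁ L) (hadd₂ L) (hgal L)).coindFin (κ.layerSubgroup N))
    (fun L _ ↦ shapiroLift (W.torsionGaloisModule ((p ^ L : ℕ) : ℤ)).toTopRep (κ.layerSubgroup N)
      (κ.isOpen_layerSubgroup N) hs hs1
      (mapH1AddHom (subgroupRep (W.torsionGaloisModule ((p : ℤ) ^ L)).toTopRep (κ.layerSubgroup N))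
        (subgroupRep (W.torsionGaloisModule ((p ^ L : ℕ) : ℤ)).toTopRep (κ.layerSubgroup N)) (r L) (hrc L) (hrρ L)
        (reduceH1Pk W p L (κ.layerSubgroup N) x)))
    (fun L hL ↦ shapiroCup_weil_htrans_reduceH1Pk W (κ.layerSubgroup N) (κ.isOpen_layerSubgroup N) hs hs1 L₀ e hμ
      hadd₁ hadd₂ hgal hcompat ψ (fun L' hL' y ↦ (hψ L' hL' y).trans (hψ L₀ le_rfl y).symm) r hrc hrρ hr x L hL)

/-- **The same, fed with the data of the registered stub `stub_ptOrthLayerTwo` (skeleton v8).**  Over `ℚ`, at the place `v ∋ p`,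
for a Weil FAMILY `e k : E[p^k] × E[p^k] → μ_{p^k}` with the ONE-STEP compatibility (WEIL) «`e (k+1) S' T' = e k S T` when `S = p S'`,
`T' = T` on points», a layer `N`, a level `L₀`, `x ∈ H¹(Γ_N, T_pE)`, a layer Selmer class `t` with a cocycle `φ_N` KILLED BY `p^{L₀}`
and ONE lift `ψ₀ : Γ_N → E[p^{L₀}]` of `φ_N` (same values):
`2 • inv_v( loc_v( Sh_{Γ_N}(red_{p^{L₀}} x) ∪_{Σ e_{L₀}} Sh_{Γ_N}[ψ₀] ) ) = 0`
— the first factor is the reduced class ITSELF (the levels `(p:ℤ)^{L₀}` and `((p^{L₀}:ℕ):ℤ)` agree definitionally), the lifts at the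
higher levels are produced inside (`LayerFinite.exists_torsionCocycle_of_zsmul_eq_zero`), the other finite places of `ℚ` are prime to `p`
(`natCast_mem_asIdeal_iff_eq_primesEquiv_symm`), and (WEIL) gives the tower compatibility (`weilFamily_hcompat_of_step`). What is left
for `stub_ptOrthLayerTwo` after this: the identification of `inv_v(loc_v(…))` with `layerPairingPk … N L₀ x ⟨p^{L₀} Q', _⟩`
(w3's `LayerGlobalShapiro.invAt_localization_cupProduct_shapiroLift_layer` + `layerKummer_eq_oneCocycleClass`, lead's T3).
[cite: Kobayashi2003, (7.16)–(7.21) (p. 12)] [cite: MilneADT2006, Ch. I, Thm. 4.10(b)] [cite: SilvermanAEC2009, Prop. III.8.1(e)] -/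
theorem two_nsmul_localInvariantMap_weilShapiroCup_eq_zero_of_step [Fintype (absoluteGaloisGroup ℚ ⧸ κ.layerSubgroup N)]
    (v : HeightOneSpectrum (𝓞 ℚ)) (hv : ((p : ℕ) : 𝓞 ℚ) ∈ v.asIdeal)
    (e : ∀ k : ℕ, geomTorsion W ((p ^ k : ℕ) : ℤ) → geomTorsion W ((p ^ k : ℕ) : ℤ) → AlgebraicClosure ℚ)
    (hμ : ∀ (k : ℕ) S T, e k S T ^ (p ^ k) = 1)
    (hadd₁ : ∀ (k : ℕ) S₁ S₂ T, e k (S₁ + S₂) T = e k S₁ T * e k S₂ T)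
    (hadd₂ : ∀ (k : ℕ) S T₁ T₂, e k S (T₁ + T₂) = e k S T₁ * e k S T₂)
    (hgal : ∀ (k : ℕ) (σ : absoluteGaloisGroup ℚ) S T, σ • e k S T = e k (σ • S) (σ • T))
    (hstep : ∀ (k : ℕ) (S' : geomTorsion W ((p ^ (k + 1) : ℕ) : ℤ)) (S : geomTorsion W ((p ^ k : ℕ) : ℤ))
      (T' : geomTorsion W ((p ^ (k + 1) : ℕ) : ℤ)) (T : geomTorsion W ((p ^ k : ℕ) : ℤ)),
      (S : W.geomPoints) = (p : ℤ) • (S' : W.geomPoints) → (T' : W.geomPoints) = (T : W.geomPoints) →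
      e (k + 1) S' T' = e k S T)
    (L₀ : ℕ) (x : H1 (tateRep W p) (κ.layerSubgroup N))
    {t : W.subgroupH1 p (κ.layerSubgroup N)} (ht : t ∈ W.selmerLayer κ N)
    (φN : contOneCocycles (discreteTopRep (κ.layerSubgroup N) (W.geomPrimaryTorsion p))) (hφN : oneCocycleClass _ φN = t)
    (hkill : ∀ y : κ.layerSubgroup N, (p ^ L₀ : ℕ) • ((φN.1 y : W.geomPrimaryTorsion p) : W.geomPoints) = 0)
    (ψ₀ : contOneCocycles (subgroupRep (W.torsionGaloisModule ((p ^ L₀ : ℕ) : ℤ)).toTopRep (κ.layerSubgroup N)))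
    (hψ₀ : ∀ y : κ.layerSubgroup N,
      ((ψ₀.1 y : geomTorsion W ((p ^ L₀ : ℕ) : ℤ)) : W.geomPoints) = ((φN.1 y : W.geomPrimaryTorsion p) : W.geomPoints)) :
    haveI : CompactSpace (absoluteGaloisGroup ℚ) := absoluteGaloisGroup_compactSpace ℚ
    2 • localInvariantMap ℚ (p ^ L₀) v (galoisCohomology.localization (mu ℚ (p ^ L₀)) (Sum.inr v) 2
      (((weilContPairing W (p ^ L₀) (e L₀) (hμ L₀) (hadd₁ L₀) (hadd₂ L₀) (hgal L₀)).coindFin (κ.layerSubgroup N)).cupProduct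
        (shapiroLift (W.torsionGaloisModule ((p ^ L₀ : ℕ) : ℤ)).toTopRep (κ.layerSubgroup N) (κ.isOpen_layerSubgroup N) hs hs1
          (reduceH1Pk W p L₀ (κ.layerSubgroup N) x))
        (shapiroLift (W.torsionGaloisModule ((p ^ L₀ : ℕ) : ℤ)).toTopRep (κ.layerSubgroup N) (κ.isOpen_layerSubgroup N) hs hs1
          (oneCocycleClass _ ψ₀)))) = 0 := by
  haveI : CompactSpace (absoluteGaloisGroup ℚ) := absoluteGaloisGroup_compactSpace ℚ
  -- (1) the other finite places of `ℚ` are prime to `p`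
  have hv₀ : ∀ w : HeightOneSpectrum (𝓞 ℚ), w ≠ v → ((p : ℕ) : 𝓞 ℚ) ∉ w.asIdeal := fun w hw hpw ↦
    hw (((natCast_mem_asIdeal_iff_eq_primesEquiv_symm w hp.out).mp hpw).trans
      ((natCast_mem_asIdeal_iff_eq_primesEquiv_symm v hp.out).mp hv).symm)
  -- (2) finite-level lifts of `φ_N` at every level `L ≥ L₀`
  have hlift : ∀ L : ℕ, L₀ ≤ L →
      ∃ ψ : contOneCocycles (subgroupRep (W.torsionGaloisModule ((p ^ L : ℕ) : ℤ)).toTopRep (κ.layerSubgroup N)),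
        ∀ y, ((ψ.1 y : geomTorsion W ((p ^ L : ℕ) : ℤ)) : W.geomPoints) =
          ((φN.1 y : W.geomPrimaryTorsion p) : W.geomPoints) := fun L hL ↦
    LayerFinite.exists_torsionCocycle_of_zsmul_eq_zero W p (κ.layerSubgroup N) ((p ^ L : ℕ) : ℤ) φN fun y ↦ by
      obtain ⟨j, rfl⟩ := Nat.exists_eq_add_of_le hL
      rw [natCast_zsmul, pow_add, mul_comm, mul_smul, hkill, smul_zero]
  choose ψ hψ using hlift
  -- (3) the re-typings `E[(p:ℤ)^L] ⊆ E[((p^L:ℕ):ℤ)]` (an equality of subgroups of `E(ℚ̄)`)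
  have hle : ∀ L : ℕ, geomTorsion W ((p : ℤ) ^ L) ≤ geomTorsion W ((p ^ L : ℕ) : ℤ) := fun L ↦
    W.geomTorsion_le_of_dvd (by rw [Nat.cast_pow])
  -- (4) the assembled statement for the family `ψ` and the re-typed reductions
  have hmain := two_nsmul_localInvariantMap_weilShapiroCup_eq_zero W κ N hs hs1 v hv₀ ht φN hφN L₀ ψ hψ e hμ hadd₁
    hadd₂ hgal (fun L hL α β hα hβ ↦ weilFamily_hcompat_of_step W e hstep L₀ L hL α β hα hβ)
    (fun L ↦ AddSubgroup.inclusion (hle L)) (fun L ↦ continuous_of_discreteTopology)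
    (fun L ↦ coeMap_subgroupRep W (AddSubgroup.inclusion (hle L)) (fun _ ↦ rfl) (κ.layerSubgroup N)) (fun L P ↦ rfl) x
  -- (5) the re-typed reduction IS the reduction, and `[ψ L₀] = [ψ₀]` (same values)
  have h1 : mapH1AddHom (subgroupRep (W.torsionGaloisModule ((p : ℤ) ^ L₀)).toTopRep (κ.layerSubgroup N))
      (subgroupRep (W.torsionGaloisModule ((p ^ L₀ : ℕ) : ℤ)).toTopRep (κ.layerSubgroup N))
      (AddSubgroup.inclusion (hle L₀)) continuous_of_discreteTopology
      (coeMap_subgroupRep W (AddSubgroup.inclusion (hle L₀)) (fun _ ↦ rfl) (κ.layerSubgroup N))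
      (reduceH1Pk W p L₀ (κ.layerSubgroup N) x) =
      (reduceH1Pk W p L₀ (κ.layerSubgroup N) x :
        continuousCohomology 1 (subgroupRep (W.torsionGaloisModule ((p ^ L₀ : ℕ) : ℤ)).toTopRep (κ.layerSubgroup N))) := by
    obtain ⟨φ, rfl⟩ := oneCocycleClass_surjective _ x
    rw [reduceH1Pk_oneCocycleClass, mapH1AddHom_oneCocycleClass]
    exact congrArg _ (Subtype.ext (ContinuousMap.ext fun _ ↦ rfl))
  have h2 : oneCocycleClass _ (ψ L₀ le_rfl) = oneCocycleClass _ ψ₀ :=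
    congrArg _ (Subtype.ext (ContinuousMap.ext fun y ↦ Subtype.ext ((hψ L₀ le_rfl y).trans (hψ₀ y).symm)))
  rw [h1, h2] at hmain
  exact hmain

end SignedKatoOffTwo.LayerPTW2

end Summit.BirchSwinnertonDyer.BirchSwinnertonDyer.Theorems

end
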